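import Summits.CriticalPhenomena.PercolationContinuityZ3.Theorems.PercNonProliferationNonProliferationOfOneRatioMultiCrossers
import HarnessLib

/-!
# Crux `PercNonProliferation.NonProliferation` (stmt-CriticalPhenomena-4444), line `avoidance-cost-covering`:
# uniform tightness of the shell-crosser count at ONE ratio implies the crux

Lead file (prover-line-stmt-CriticalPhenomena-4444-a1). The family socket
`nonProliferation_of_oneRatioMultiCrossers` (p130211) closes the crux from any member `C(r, k₀)`:
`(k₀+1)² · sup_{a ≥ a₀} P_{p_c}(r+1 shell-distinct crossers of Sh(a, k₀ a)) < 1`. The cleanest conjecture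
containing every member is UNIFORM TIGHTNESS of the number `N(a, k₀ a)` of shell-distinct crossers at one
fixed ratio `k₀ ≥ 2`, uniformly in the inner scale `a`:

  `∀ ε > 0, ∃ r a₀, ∀ a ≥ a₀, P_{p_c}(N(a, k₀ a) ≥ r + 1) ≤ ε`

(the scale-invariance / hyperscaling picture: the law of `N(a, k₀ a)` converges as `a → ∞`; measured for
`k₀ = 4, 6` over `a = 2 … 48` with `a^{-0.8}` corrections, kit j020668). This file records
`nonProliferation_of_uniformShellTightness`: uniform tightness at any one ratio `k₀ ≥ 2` implies the crux
(take `ε` with `(k₀+1)² ε < 1`). It is the statement a planner can file as the standing conjecture behind the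
line; the registered open stub `stub_oneRatioThreeCrossers` is its three-crosser/large-ratio quantile.
-/

noncomputable section

namespace Summit.CriticalPhenomena.PercolationContinuityZ3.Theorems.NonProliferation

open MeasureTheory Filter Topology
open Literature.Probability.LatticeModels Literature.Probability.Percolation

/-- **Uniform tightness of the shell-crosser count at one ratio implies the crux.** If for some ratio
`k₀ ≥ 2` the number of shell-distinct crossers of `Sh(a, k₀ a)` is tight UNIFORMLY in the scale — for every
`ε > 0` there are a multiplicity `r` and a scale `a₀ ≥ 1` with
`P_{p_c}(r+1 shell-distinct crossers of Sh(a, k₀ a)) ≤ ε` for all `a ≥ a₀` — then `NonProliferation` holds: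
the member `C(r, k₀)` of the one-ratio family with `ε := 1 / (2 (k₀+1)²)` feeds
`nonProliferation_of_oneRatioMultiCrossers`. -/
theorem nonProliferation_of_uniformShellTightness :
    (∃ k₀ : ℕ, 2 ≤ k₀ ∧ ∀ ε : ℝ, 0 < ε → ∃ r a₀ : ℕ, 1 ≤ a₀ ∧ ∀ a : ℕ, a₀ ≤ a →
      (bondPercolation (zdGraph 3) (criticalProbI 3)).real
        {ω | ∃ x : Fin (r + 1) → Site 3, (∀ i, x i ∈ box 3 a) ∧
          (∀ i, ∃ y ∈ innerBoundary (zdGraph 3) (box 3 (k₀ * a)),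
            ω ∈ openConnIn {v : Site 3 | v ∈ box 3 (k₀ * a) ∧ ∃ l : Fin 3, (a : ℤ) ≤ |v l|} (x i) y) ∧
          ∀ i j, i ≠ j →
            ω ∉ openConnIn {v : Site 3 | v ∈ box 3 (k₀ * a) ∧ ∃ l : Fin 3, (a : ℤ) ≤ |v l|} (x i) (x j)}
        ≤ ε) →
    Summit.CriticalPhenomena.PercolationContinuityZ3.Theses.PercNonProliferation.NonProliferation := by
  rintro ⟨k₀, hk₀, htight⟩
  have hK : (0 : ℝ) < ((k₀ : ℝ) + 1) ^ 2 := by positivity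
  obtain ⟨r, a₀, ha₀, hle⟩ := htight (1 / (2 * ((k₀ : ℝ) + 1) ^ 2)) (by positivity)
  refine nonProliferation_of_oneRatioMultiCrossers ⟨r, k₀, a₀, 1 / (2 * ((k₀ : ℝ) + 1) ^ 2), hk₀, ha₀, ?_, hle⟩
  rw [mul_one_div, div_lt_one (by positivity)]
  linarith

end Summit.CriticalPhenomena.PercolationContinuityZ3.Theorems.NonProliferation

end
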